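import Summits.CriticalPhenomena.SAWScalingLimit.Theorems.SAWSpinMonotoneArrivalFlatteningSpinChordDefs
import Summits.CriticalPhenomena.SAWScalingLimit.Theorems.SAWDevelopingMapHexTightSignedVisitingBound

/-!
# The stub `stub_exitSpinBound` of the line `spin-chord` (crux `ArrivalFlattening`)

Crux `stmt-CriticalPhenomena-16770`
(`Summit.CriticalPhenomena.SAWScalingLimit.Theses.SAWSpinMonotone.ArrivalFlattening`), line
`spin-chord` (checked skeleton `Cruxes/ArrivalFlattening/Lines/spin_chord.lean`), registered stub
`stub_exitSpinBound : ExitSpinBound` over the vocabulary module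
`…Theorems.SAWSpinMonotoneArrivalFlatteningSpinChordDefs` (`arrivalTransform`, `AtDepth`,
`ThroughMass`, `ExitSpinBound`).

**Statement (exit-spin identity and bound).** For a simply connected honeycomb domain `Λ`, a
boundary mid-edge `a = {u, c₀}` (`c₀ ∈ Λ`, `u ∉ Λ`), a `1`-deep vertex `v ∈ Λ` (all three
neighbours of `v` lie in `Λ`) and its three ports `w₀, w₁, w₂`:
`‖A_v(3/8)‖ ≤ ThroughMass Λ a v`, where `A_v(s) = Σⱼ F_{Λ∖v}(a, {v, wⱼ}; x_c, s)`.

**Proof** (the computation of `…Theorems.SAWDevelopingMapHexTightSignedVisitingBound` with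
`U = {v}`).
1. DCS Lemma 1 holds for `F = F_Λ(a; x_c, 5/8)` on `Λ` and for `G = F_{Λ∖v}(a; x_c, 5/8)` on the
   punctured domain `Λ ∖ {v}` (`satisfiesVertexRelations_of_subset`: the entrance lies outside
   every cycle of `Λ ⊇ Λ ∖ {v}`), so the strong-Markov flux identity `flux_identity` gives
   `MAIN(F) − MAIN(G) = DOOR(G) − WALL(F)`.
2. `WALL(F) = 0`: at depth `1` no neighbour of `v` lies outside `Λ`.
3. `DOOR(G) = Σⱼ term G wⱼ v = ((c_{c₀} − c_u)/2) · conj A_v(3/8)`: `v ∉ Λ ∖ {v}`, so every walk of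
   `Λ ∖ {v}` from `a` to the port `{wⱼ, v}` ends at `wⱼ`, its unit tangent has turned by
   `e^{iW}` (`term_weight_eq`), and `e^{i(3/8)W} x_c^ℓ = conj(e^{-i(3/8)W} x_c^ℓ)`.
4. `‖MAIN(F) − MAIN(G)‖ ≤ (1/(2√3)) · ThroughMass`: termwise `F − G` is the sum over the
   `v`-visiting walks (`observable_sub_observable_sdiff`), whose weights have moduli `x_c^ℓ`,
   and at spin `0` both observables are the real masses, so
   `‖(F − G)(z; 5/8)‖ ≤ ‖F(z; 0)‖ − ‖G(z; 0)‖`; `‖mid{y,w} − c_y‖ = 1/(2√3)`.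
5. `‖(c_{c₀} − c_u)/2‖ = 1/(2√3)`; cancel.

Source: H. Duminil-Copin, S. Smirnov, Ann. of Math. 175 (2012) 1653–1665 (arXiv:1007.0575),
Lemma 1 and §3 (summing the vertex relation over a domain).

Notes for the skeleton: the reusable pieces are `norm_sub_sdiff_le` (through-`U` domination for
any `U`, root in `Λ ∖ U`), `term_port_eq` (DOOR term at a port of a punctured domain),
`door_sum_eq` and `nbrs_eq_of_adj₃`; the proof works with `Λ \ {v}` throughout and converts to
`Λ.erase v` only at the end (`Finset.sdiff_singleton_eq_erase`).
-/

noncomputable section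

open Literature.Probability.RandomPlanarGeometry Literature.Probability.RandomPlanarGeometry.SAW
  Literature.Probability.LatticeModels
open Literature.Barriers.CriticalPhenomena
open Literature.Barriers.CriticalPhenomena.HexGreen (nbrs mem_nbrs_iff mem_nbrs_comm)
open Summit.CriticalPhenomena.SAWScalingLimit.Theorems.HexTight.SumRule
open scoped BigOperators Classical ComplexConjugate

namespace Summit.CriticalPhenomena.SAWScalingLimit.Cruxes.ArrivalFlattening.SpinChord

/-! ### Through-`U` domination -/

/-- **Through-domination.** If the root `a` is a mid-edge of `Λ ∖ U`, then for every spin `σ`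
`‖F_Λ(a,z;x_c,σ) − F_{Λ∖U}(a,z;x_c,σ)‖ ≤ ‖F_Λ(a,z;x_c,0)‖ − ‖F_{Λ∖U}(a,z;x_c,0)‖`: the difference
is the sum over the `U`-visiting walks (`observable_sub_observable_sdiff`), the winding factors
are unimodular, and at spin `0` both observables are the real non-negative masses. [folklore] -/
theorem norm_sub_sdiff_le {Λ U : Finset HexVertex} {a : Sym2 HexVertex}
    (ha : a ∈ hexDomainMidEdges (Λ \ U)) (σ : ℝ) (z : Sym2 HexVertex) :
    ‖hexParafermionicObservable Λ a hexCriticalFugacity σ z -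
        hexParafermionicObservable (Λ \ U) a hexCriticalFugacity σ z‖ ≤
      ‖hexParafermionicObservable Λ a hexCriticalFugacity 0 z‖ -
        ‖hexParafermionicObservable (Λ \ U) a hexCriticalFugacity 0 z‖ := by
  have hx : (0 : ℝ) ≤ hexCriticalFugacity := hexCriticalFugacity_pos_lt_one.1.le
  set m : ℝ := ∑ γ : HexMidEdgeSAW Λ a z,
    (if Visits γ U then hexCriticalFugacity ^ γ.length else 0) with hm
  set g : ℝ := ∑ γ : HexMidEdgeSAW (Λ \ U) a z, hexCriticalFugacity ^ γ.length with hg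
  have hm0 : 0 ≤ m :=
    Finset.sum_nonneg fun γ _ => by split_ifs; exacts [pow_nonneg hx _, le_rfl]
  have hg0 : 0 ≤ g := Finset.sum_nonneg fun γ _ => pow_nonneg hx _
  have hσ : ‖hexParafermionicObservable Λ a hexCriticalFugacity σ z -
      hexParafermionicObservable (Λ \ U) a hexCriticalFugacity σ z‖ ≤ m := by
    rw [observable_sub_observable_sdiff ha, hm]
    refine (norm_sum_le _ _).trans (le_of_eq (Finset.sum_congr rfl fun γ _ => ?_))
    split_ifs
    · exact γ.norm_weight hx σ
    · exact norm_zero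
  have h0 : hexParafermionicObservable Λ a hexCriticalFugacity 0 z -
      hexParafermionicObservable (Λ \ U) a hexCriticalFugacity 0 z = (m : ℂ) := by
    rw [observable_sub_observable_sdiff ha, hm, Complex.ofReal_sum]
    refine Finset.sum_congr rfl fun γ _ => ?_
    split_ifs
    · rw [γ.weight_zero_spin, Complex.ofReal_pow]
    · exact Complex.ofReal_zero.symm
  have hG : hexParafermionicObservable (Λ \ U) a hexCriticalFugacity 0 z = (g : ℂ) :=
    hexParafermionicObservable_zero_spin (Λ \ U) a hexCriticalFugacity z
  have hF : hexParafermionicObservable Λ a hexCriticalFugacity 0 z = ((m + g : ℝ) : ℂ) := by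
    rw [Complex.ofReal_add, ← hG, ← h0, sub_add_cancel]
  rw [hF, hG, Complex.norm_real, Complex.norm_real, Real.norm_of_nonneg (add_nonneg hm0 hg0),
    Real.norm_of_nonneg hg0, add_sub_cancel_right]
  exact hσ

/-! ### Geometry of the honeycomb star -/

/-- Half an edge: `‖mid{y,w} − c_y‖ = 1/(2√3)` for `y ∼ w`. [folklore] -/
theorem norm_hexMidpoint_sub_hexCenter {y w : HexVertex} (hyw : hexGraph.Adj y w) :
    ‖hexMidpoint s(y, w) - hexCenter y‖ = (Real.sqrt 3)⁻¹ / 2 := by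
  rw [hexMidpoint_mk, show (hexCenter y + hexCenter w) / 2 - hexCenter y =
    (hexCenter w - hexCenter y) / 2 by ring, norm_div, norm_hexCenter_sub_of_adj hyw]
  simp

/-- Three pairwise distinct neighbours of `v` exhaust `nbrs v`. [folklore] -/
theorem nbrs_eq_of_adj₃ {v w₀ w₁ w₂ : HexVertex} (h₀ : hexGraph.Adj v w₀)
    (h₁ : hexGraph.Adj v w₁) (h₂ : hexGraph.Adj v w₂) (h01 : w₀ ≠ w₁) (h12 : w₁ ≠ w₂)
    (h02 : w₀ ≠ w₂) : nbrs v = {w₀, w₁, w₂} := by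
  symm
  refine Finset.eq_of_subset_of_card_le (fun w hw => ?_) ?_
  · simp only [Finset.mem_insert, Finset.mem_singleton] at hw
    rcases hw with rfl | rfl | rfl
    · exact (mem_nbrs_iff _ _).2 h₀
    · exact (mem_nbrs_iff _ _).2 h₁
    · exact (mem_nbrs_iff _ _).2 h₂
  · rw [Finset.card_eq_three.2 ⟨w₀, w₁, w₂, h01, h02, h12, rfl⟩]
    unfold nbrs
    split_ifs <;> exact Finset.card_le_three

/-! ### The DOOR side: ports of the punctured domain -/

/-- The DOOR sum of the flux identity for `U = {v}` is the sum over the neighbours of `v`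
(all of which lie in `Λ ∖ {v}`). [folklore] -/
theorem door_sum_eq {Λ : Finset HexVertex} {v : HexVertex} (G : Sym2 HexVertex → ℂ)
    (hsub : nbrs v ⊆ Λ \ {v}) :
    ∑ y ∈ Λ \ {v}, ∑ w ∈ (nbrs y).filter (fun w => w ∈ ({v} : Finset HexVertex)),
        HexKernel.term G y w = ∑ y ∈ nbrs v, HexKernel.term G y v := by
  have hinner : ∀ y, ∑ w ∈ (nbrs y).filter (fun w => w ∈ ({v} : Finset HexVertex)),
      HexKernel.term G y w = if y ∈ nbrs v then HexKernel.term G y v else 0 := by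
    intro y
    by_cases h : y ∈ nbrs v
    · rw [if_pos h]
      have hf : (nbrs y).filter (fun w => w ∈ ({v} : Finset HexVertex)) = {v} := by
        ext w
        simp only [Finset.mem_filter, Finset.mem_singleton]
        refine ⟨fun hw => hw.2, fun hw => ⟨?_, hw⟩⟩
        rw [hw]
        exact (mem_nbrs_comm y v).2 h
      rw [hf, Finset.sum_singleton]
    · rw [if_neg h]
      refine Finset.sum_eq_zero fun w hw => ?_
      simp only [Finset.mem_filter, Finset.mem_singleton] at hw
      obtain ⟨hwy, rfl⟩ := hw
      exact absurd ((mem_nbrs_comm y w).1 hwy) h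
  rw [Finset.sum_congr rfl fun y _ => hinner y, ← Finset.sum_filter, Finset.filter_mem_eq_inter,
    Finset.inter_eq_right.2 hsub]

/-- `e^{i(3/8)W} x_c^ℓ` is the complex conjugate of the spin-`3/8` weight `e^{-i(3/8)W} x_c^ℓ`
(`W` and `x_c` are real). [folklore] -/
theorem conj_weight_three_eighths {Λ : Finset HexVertex} {a z : Sym2 HexVertex}
    (γ : HexMidEdgeSAW Λ a z) :
    conj (γ.weight hexCriticalFugacity (3 / 8)) =
      Complex.exp (Complex.I * (3 / 8 : ℂ) * (γ.winding : ℂ)) *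
        (hexCriticalFugacity : ℂ) ^ γ.length := by
  have harg : conj (-Complex.I * ((3 / 8 : ℝ) : ℂ) * ((γ.winding : ℝ) : ℂ)) =
      Complex.I * (3 / 8 : ℂ) * (γ.winding : ℂ) := by
    simp only [map_mul, map_neg, Complex.conj_I, Complex.conj_ofReal, neg_neg]
    push_cast
    ring
  rw [HexMidEdgeSAW.weight, map_mul, map_pow, Complex.conj_ofReal, ← Complex.exp_conj, harg]

/-- **The DOOR term at a port.** In a domain `Λ'` not containing `u` nor `v`, rooted at
`{u, c₀}` (`u ∼ c₀`, `u ≠ v`), for a vertex `w ∈ Λ'` adjacent to `v`: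
`term F_{Λ'}(·; x_c, 5/8) w v = ((c_{c₀} − c_u)/2) · conj F_{Λ'}(a, {v, w}; x_c, 3/8)` — every walk
to the port `{w, v}` ends at `w` heading towards `v`. [folklore] -/
theorem term_port_eq {Λ' : Finset HexVertex} {u c₀ v w : HexVertex} (huc : hexGraph.Adj u c₀)
    (hu : u ∉ Λ') (hv : v ∉ Λ') (huv : u ≠ v) (hwv : hexGraph.Adj w v) (hw : w ∈ Λ') :
    HexKernel.term (hexParafermionicObservable Λ' s(u, c₀) hexCriticalFugacity (5 / 8)) w v =
      (hexCenter c₀ - hexCenter u) / 2 *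
        conj (hexParafermionicObservable Λ' s(u, c₀) hexCriticalFugacity (3 / 8) s(v, w)) := by
  rw [Sym2.eq_swap (a := v) (b := w), HexKernel.term, hexParafermionicObservable,
    hexParafermionicObservable, Finset.mul_sum, map_sum, Finset.mul_sum]
  refine Finset.sum_congr rfl fun γ _ => ?_
  have hne : γ.verts ≠ [] := by
    intro h0
    have he : s(u, c₀) = s(w, v) := γ.eq_of_nil h0
    have hu' : u ∈ s(w, v) := he ▸ Sym2.mem_mk_left u c₀
    rcases Sym2.mem_iff.1 hu' with rfl | rfl
    · exact hu hw
    · exact huv rfl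
  calc (hexMidpoint s(w, v) - hexCenter w) * γ.weight hexCriticalFugacity (5 / 8)
      = (hexCenter c₀ - hexCenter u) / 2 *
          (Complex.exp (Complex.I * (3 / 8 : ℂ) * (γ.winding : ℂ)) *
            (hexCriticalFugacity : ℂ) ^ γ.length) := term_weight_eq huc hu hwv hv γ hne
    _ = _ := by rw [conj_weight_three_eighths]

/-! ### The MAIN side: through-`v` domination on the outer boundary -/

/-- **MAIN bound.** For `c₀ ∈ Λ ∖ {v}`, `u ∼ c₀`, and a `1`-deep `v ∈ Λ` (all neighbours of `v` in
`Λ`): `‖MAIN(F_Λ) − MAIN(F_{Λ∖v})‖ ≤ (1/(2√3)) · ThroughMass`, the through-mass written as the sum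
over ALL `y ∈ Λ` of the outer darts `(t, y)`, `t ∉ Λ` (the `y = v` term is empty). [folklore] -/
theorem norm_main_sub_main_le {Λ : Finset HexVertex} {u c₀ v : HexVertex}
    (hc₀ : c₀ ∈ Λ \ {v}) (huc : hexGraph.Adj u c₀) (hv : v ∈ Λ)
    (hnb : ∀ t, hexGraph.Adj v t → t ∈ Λ) :
    ‖(∑ y ∈ Λ \ {v}, ∑ w ∈ (nbrs y).filter (fun w => w ∉ Λ),
        HexKernel.term (hexParafermionicObservable Λ s(u, c₀) hexCriticalFugacity (5 / 8)) y w) -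
      (∑ y ∈ Λ \ {v}, ∑ w ∈ (nbrs y).filter (fun w => w ∉ Λ),
        HexKernel.term
          (hexParafermionicObservable (Λ \ {v}) s(u, c₀) hexCriticalFugacity (5 / 8)) y w)‖ ≤
    (Real.sqrt 3)⁻¹ / 2 * ∑ y ∈ Λ, ∑ t ∈ (nbrs y).filter (· ∉ Λ),
      (‖hexParafermionicObservable Λ s(u, c₀) hexCriticalFugacity 0 s(t, y)‖ -
        ‖hexParafermionicObservable (Λ \ {v}) s(u, c₀) hexCriticalFugacity 0 s(t, y)‖) := by
  have ha' : s(u, c₀) ∈ hexDomainMidEdges (Λ \ {v}) :=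
    ⟨(SimpleGraph.mem_edgeSet hexGraph).2 huc, c₀, Sym2.mem_mk_right u c₀, hc₀⟩
  have hU : ({v} : Finset HexVertex) ⊆ Λ := Finset.singleton_subset_iff.2 hv
  have hv0 : ∑ t ∈ (nbrs v).filter (· ∉ Λ),
      (‖hexParafermionicObservable Λ s(u, c₀) hexCriticalFugacity 0 s(t, v)‖ -
        ‖hexParafermionicObservable (Λ \ {v}) s(u, c₀) hexCriticalFugacity 0 s(t, v)‖) = 0 :=
    Finset.sum_eq_zero fun t ht => by
      obtain ⟨htn, htΛ⟩ := Finset.mem_filter.1 ht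
      exact absurd (hnb t ((mem_nbrs_iff v t).1 htn)) htΛ
  rw [← Finset.sum_sdiff hU, Finset.sum_singleton, hv0, add_zero, ← Finset.sum_sub_distrib,
    Finset.mul_sum]
  refine (norm_sum_le _ _).trans (Finset.sum_le_sum fun y _ => ?_)
  rw [← Finset.sum_sub_distrib, Finset.mul_sum]
  refine (norm_sum_le _ _).trans (Finset.sum_le_sum fun w hw => ?_)
  have hyw : hexGraph.Adj y w := (mem_nbrs_iff y w).1 (Finset.mem_filter.1 hw).1
  rw [HexKernel.term, HexKernel.term, ← mul_sub, norm_mul, norm_hexMidpoint_sub_hexCenter hyw,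
    Sym2.eq_swap (a := w) (b := y)]
  exact mul_le_mul_of_nonneg_left (norm_sub_sdiff_le ha' (5 / 8) s(y, w)) (by positivity)

/-! ### The stub -/

/-- **S3 `stub_exitSpinBound` — the exit-spin bound.** At every `1`-deep configuration
`‖A_v(3/8)‖ ≤ ThroughMass Λ a v`: the punctured contour identity (DCS Lemma 1 summed over
`Λ ∖ {v}` with the outer root, minus the same sum over `Λ`) equates `((c_{c₀} − c_u)/2) conj A_v(3/8)`
with the MAIN difference, whose modulus is at most `(1/(2√3))` times the through-`v` mass. -/
theorem stub_exitSpinBound : ExitSpinBound := by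
  intro Λ hΛ a ha v hv hball w₀ w₁ w₂ hw₀ hw₁ hw₂ h01 h12 h02
  obtain ⟨haE, u, c₀, rfl, hc₀, hu⟩ := ha
  have huc : hexGraph.Adj u c₀ := (SimpleGraph.mem_edgeSet hexGraph).1 haE
  -- depth 1: every neighbour of `v` lies in `Λ` (honeycomb edges have length `1/√3 ≤ 1`)
  have hnb : ∀ t, hexGraph.Adj v t → t ∈ Λ := fun t ht => hball t (by
    rw [dist_eq_norm, norm_hexCenter_sub_of_adj ht]
    exact inv_le_one_of_one_le₀ (Real.one_le_sqrt.2 (by norm_num)))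
  have hc₀v : c₀ ≠ v := by
    rintro rfl
    exact hu (hnb u huc.symm)
  have huv : u ≠ v := by
    rintro rfl
    exact hu hv
  have hU : ({v} : Finset HexVertex) ⊆ Λ := Finset.singleton_subset_iff.2 hv
  have hc₀' : c₀ ∈ Λ \ {v} := Finset.mem_sdiff.2 ⟨hc₀, by rwa [Finset.mem_singleton]⟩
  have hu' : u ∉ Λ \ {v} := fun h => hu (Finset.sdiff_subset h)
  have hvΛ' : v ∉ Λ \ {v} := by simp
  have hnbΛ' : nbrs v ⊆ Λ \ {v} := fun t ht => by
    have hvt : hexGraph.Adj v t := (mem_nbrs_iff v t).1 ht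
    exact Finset.mem_sdiff.2 ⟨hnb t hvt, by rw [Finset.mem_singleton]; exact hvt.ne.symm⟩
  -- (1) the flux identity `MAIN(F) − MAIN(G) = DOOR(G) − WALL(F)` with `U = {v}`
  have hident := flux_identity hU (satisfiesVertexRelations_of_subset hΛ subset_rfl huc hu hc₀)
    (satisfiesVertexRelations_of_subset hΛ Finset.sdiff_subset huc hu hc₀')
  -- (2) no walls at depth 1
  have hwall : ∑ y ∈ ({v} : Finset HexVertex), ∑ w ∈ (nbrs y).filter (fun w => w ∉ Λ),
      HexKernel.term (hexParafermionicObservable Λ s(u, c₀) hexCriticalFugacity (5 / 8)) y w =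
        0 := by
    rw [Finset.sum_singleton]
    exact Finset.sum_eq_zero fun w hw => by
      obtain ⟨hwn, hwΛ⟩ := Finset.mem_filter.1 hw
      exact absurd (hnb w ((mem_nbrs_iff v w).1 hwn)) hwΛ
  -- (3) the door terms are the conjugate arrival transform times half the entrance edge vector
  have hdoor : ∑ y ∈ Λ \ {v}, ∑ w ∈ (nbrs y).filter (fun w => w ∈ ({v} : Finset HexVertex)),
      HexKernel.term
        (hexParafermionicObservable (Λ \ {v}) s(u, c₀) hexCriticalFugacity (5 / 8)) y w =
      (hexCenter c₀ - hexCenter u) / 2 * conj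
        (hexParafermionicObservable (Λ \ {v}) s(u, c₀) hexCriticalFugacity (3 / 8) s(v, w₀) +
          hexParafermionicObservable (Λ \ {v}) s(u, c₀) hexCriticalFugacity (3 / 8) s(v, w₁) +
          hexParafermionicObservable (Λ \ {v}) s(u, c₀) hexCriticalFugacity (3 / 8)
            s(v, w₂)) := by
    have hp : ∀ w, hexGraph.Adj v w → w ∈ Λ \ {v} := fun w h => hnbΛ' ((mem_nbrs_iff _ _).2 h)
    rw [door_sum_eq _ hnbΛ', nbrs_eq_of_adj₃ hw₀ hw₁ hw₂ h01 h12 h02,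
      Finset.sum_insert (by simp [h01, h02]), Finset.sum_insert (by simpa using h12),
      Finset.sum_singleton, term_port_eq huc hu' hvΛ' huv hw₀.symm (hp w₀ hw₀),
      term_port_eq huc hu' hvΛ' huv hw₁.symm (hp w₁ hw₁),
      term_port_eq huc hu' hvΛ' huv hw₂.symm (hp w₂ hw₂), map_add, map_add]
    ring
  -- (4)-(5) combine with the MAIN bound and cancel `1/(2√3)`
  have hd : ‖(hexCenter c₀ - hexCenter u) / 2‖ = (Real.sqrt 3)⁻¹ / 2 := by
    rw [norm_div, norm_hexCenter_sub_of_adj huc]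
    simp
  have hmain := norm_main_sub_main_le hc₀' huc hv hnb
  rw [hident, hwall, sub_zero, hdoor, norm_mul, Complex.norm_conj, hd] at hmain
  show ‖arrivalTransform Λ s(u, c₀) v w₀ w₁ w₂ (3 / 8)‖ ≤ ThroughMass Λ s(u, c₀) v
  unfold arrivalTransform ThroughMass
  rw [← Finset.sdiff_singleton_eq_erase]
  exact le_of_mul_le_mul_left hmain (by positivity)

end Summit.CriticalPhenomena.SAWScalingLimit.Cruxes.ArrivalFlattening.SpinChord

end
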